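import Literature.AnabelianGeometry.EtaleTheta.Discharge.Sec2OrbitEmbeddingOuterTransport
import Literature.AnabelianGeometry.EtaleTheta.Discharge.Sec2Cor28iiiOuterOfEmbedding
import Literature.AnabelianGeometry.EtaleTheta.Discharge.Sec2Cor28iInnerOfEmbedding
import HarnessLib

/-!
# [EtTh] Cor 2.8 (iii) at the §1 model, OUTER clauses 3–4 — the ASSEMBLY: S1 (outer transport, abc-iut-w6-d051)
# instantiated in S3 (abc-iut-w6-d049, p434590), leaving P-C5 as the ONE residual input

Mochizuki, *The Étale Theta Function …* [EtTh], Publ. RIMS 45 (2009), §2, Cor 2.8 (iii), PRIMS PDF p.42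
(bib key `MochizukiEtTh2009`).  PROOF-ONLY (no `def`, no `Prop` fact; seat abc-iut-w6-d049, W6 tranche-2 row
EtTh:Cor2.8(i)/(iii), abc-iut-L2-lead 2026-08-26T08:33:17Z / SPLIT 09:05:51Z).

For the orbit data `ThetaOrbitData.ofEmbedding ε hC hS` and an OUTER conjugator `x ∈ Π^tp_Ċ` given with its
automorphism pair `(α, β)` of `(Π^tp_X, (Π^tp_X)^Θ)` THROUGH `ι` (`hα : ι (α g) = x · ι g · x⁻¹`,
`hβ : β ∘ toTheta = toTheta ∘ α`, stabilities of `Δ_Θ`, `Π^tp_Ÿ`, `Π^tp_{X̲}` / `Π^tp_{X̲̲}`) — data of abc-iut-L2-d3's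
model, hypotheses here — and `Γ_Θ` INDUCED by `γ_x` on the cyclotome (Cor28_iii's own `InducesOnTheta`):
* `ofEmbedding_transport_outer_etaLZ` — clause 4: `(γ_x, Γ_Θ) · η̈^{Θ,l·ℤ} = η̈^{Θ,l·ℤ}` MODULO P-C5
  (`autMap α⁻¹ β⁻¹ η̈^Θ = σ₀ · η̈^Θ`, `σ₀ ∈ Π^tp_{Ẋ̲} ∩ Π^tp_X`) — abc-iut-w6-d051's `outer_image_orbitColl_eq` at
  `S := dotXu` with the `dotXu`-stability derived from `x ∈ Π^tp_Ċ` (a subgroup) and the `Π^tp_{X̲}`-stability of `α`;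
* `ofEmbedding_transport_outer_rootLZ` — clause 3 likewise at `S := dotXuu` (`σ₀ ∈ Π^tp_{Ẋ̲̲} ∩ Π^tp_X`);
* `ofEmbedding_cor28_iii_outer` — the last two conjuncts of `ThetaOrbitData.Cor28_iii` verbatim, and
  `ofEmbedding_cor28_iii_all` — all four (clauses 1–2 from abc-iut-L2-t2's `ofEmbedding_cor28_iii_inner`, p427195).
So at the §1 model Cor 2.8 (iii) holds for EVERY `x ∈ Π^tp_Ċ` carrying an automorphism pair, MODULO exactly P-C5
(abc-iut-L2-d3 census: the action of the inversion on `η̈^Θ`, [EtTh] p.42 «immediate from the definitions»).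
HONEST FRAMING: [EtTh] is refereed; nothing beyond the displayed statements is claimed; P-C5 enters in theorem
position and is NOT asserted; no side is taken on [IUTchIII] Cor 3.12.
-/

noncomputable section

namespace Literature.AnabelianGeometry.EtaleTheta

open Literature.AnabelianGeometry.SemiGraphs ThetaCovers Literature.IUT.HodgeArakelov

universe u

namespace ThetaSetting.EtaleThetaData.DoubleUnderline.OrbitEmbedding

variable {p : ℕ} [Fact p.Prime] {D : ThetaSetting p} {E : D.EtaleThetaData} {l : ℕ}
  {C : E.DoubleUnderline l} {T : TemperedCoverData.{u} l} (ε : C.OrbitEmbedding T)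
  {x : T.Gtp} {α : D.PiTemp ≃ₜ* D.PiTemp} {β : D.GtpTheta ≃ₜ* D.GtpTheta}

/-- `dotXu` is carried onto itself by `s ↦ α⁻¹ s · σ₀` when `x ∈ Π^tp_Ċ`, `α` comes from `x` through `ι`,
`α^{±1}` stabilise `Π^tp_{X̲}` and `σ₀ ∈ dotXu` (the two stability inputs of abc-iut-w6-d051's
`outer_image_orbitColl_eq`). [cite: MochizukiEtTh2009, Cor 2.8(iii) p.42] -/
theorem dotXu_stable_outer (hx : x ∈ T.PiCdot) (hα : ∀ g, ε.ι (α g) = x * ε.ι g * x⁻¹)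
    (hXu : ∀ g, g ∈ D.GtpXu l → α g ∈ D.GtpXu l) (hXu' : ∀ g, g ∈ D.GtpXu l → α.symm g ∈ D.GtpXu l)
    {σ₀ : D.PiTemp} (hσ₀ : σ₀ ∈ ε.dotXu) :
    (∀ s ∈ ε.dotXu, α.symm s * σ₀ ∈ ε.dotXu) ∧ (∀ s ∈ ε.dotXu, α (s * σ₀⁻¹) ∈ ε.dotXu) := by
  refine ⟨fun s hs => ε.dotXu_mul_mem ⟨hXu' s hs.1, ?_⟩ hσ₀, fun s hs => ?_⟩
  · show ε.ι (α.symm s) ∈ T.PiCdot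
    rw [ε.ι_symm_eq hα]
    exact T.PiCdot.mul_mem (T.PiCdot.mul_mem (T.PiCdot.inv_mem hx) hs.2) hx
  · have hs' := ε.dotXu_mul_mem hs (ε.dotXu_inv_mem hσ₀)
    refine ⟨hXu _ hs'.1, ?_⟩
    show ε.ι (α (s * σ₀⁻¹)) ∈ T.PiCdot
    rw [hα]
    exact T.PiCdot.mul_mem (T.PiCdot.mul_mem hx hs'.2) (T.PiCdot.inv_mem hx)

/-- The same for `dotXuu` (`α^{±1}` stabilising `Π^tp_{X̲̲} = C.Huu`). [cite: MochizukiEtTh2009, Cor 2.8(iii) p.42] -/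
theorem dotXuu_stable_outer (hx : x ∈ T.PiCdot) (hα : ∀ g, ε.ι (α g) = x * ε.ι g * x⁻¹)
    (hU : ∀ g, g ∈ C.Huu → α g ∈ C.Huu) (hU' : ∀ g, g ∈ C.Huu → α.symm g ∈ C.Huu)
    {σ₀ : D.PiTemp} (hσ₀ : σ₀ ∈ ε.dotXuu) :
    (∀ s ∈ ε.dotXuu, α.symm s * σ₀ ∈ ε.dotXuu) ∧ (∀ s ∈ ε.dotXuu, α (s * σ₀⁻¹) ∈ ε.dotXuu) := by
  refine ⟨fun s hs => ε.dotXuu_mul_mem ⟨hU' s hs.1, ?_⟩ hσ₀, fun s hs => ?_⟩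
  · show ε.ι (α.symm s) ∈ T.PiCdot
    rw [ε.ι_symm_eq hα]
    exact T.PiCdot.mul_mem (T.PiCdot.mul_mem (T.PiCdot.inv_mem hx) hs.2) hx
  · have hs' := ε.dotXuu_mul_mem hs (ε.dotXuu_inv_mem hσ₀)
    refine ⟨hU _ hs'.1, ?_⟩
    show ε.ι (α (s * σ₀⁻¹)) ∈ T.PiCdot
    rw [hα]
    exact T.PiCdot.mul_mem (T.PiCdot.mul_mem hx hs'.2) (T.PiCdot.inv_mem hx)

/-- **Cor 2.8 (iii), clause 4 — OUTER case, modulo P-C5 only**: for `x ∈ Π^tp_Ċ` with its automorphism pair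
`(α, β)` through `ι` and `Γ_Θ` induced by `γ_x` on the cyclotome, `(γ_x, Γ_Θ) · η̈^{Θ,l·ℤ} = η̈^{Θ,l·ℤ}` at
`ofEmbedding ε hC hS`, PROVIDED (P-C5) `autMap α⁻¹ β⁻¹ η̈^Θ = σ₀ · η̈^Θ` for some `σ₀ ∈ Π^tp_{Ẋ̲} ∩ Π^tp_X`.
[cite: MochizukiEtTh2009, Cor 2.8(iii) p.42] -/
theorem ofEmbedding_transport_outer_etaLZ (hC : D.Compat) (hS : D.Sec2Hyps) (hx : x ∈ T.PiCdot)
    (hα : ∀ g, ε.ι (α g) = x * ε.ι g * x⁻¹) (hβ : ∀ g, β (D.toTheta g) = D.toTheta (α g))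
    (hΔ : ∀ a, a ∈ D.DeltaTheta → β a ∈ D.DeltaTheta) (hΔ' : ∀ a, a ∈ D.DeltaTheta → β.symm a ∈ D.DeltaTheta)
    (hY : ∀ g, g ∈ D.GtpYdd → α g ∈ D.GtpYdd) (hY' : ∀ g, g ∈ D.GtpYdd → α.symm g ∈ D.GtpYdd)
    (hXu : ∀ g, g ∈ D.GtpXu l → α g ∈ D.GtpXu l) (hXu' : ∀ g, g ∈ D.GtpXu l → α.symm g ∈ D.GtpXu l)
    (ΓΘ : (ThetaOrbitData.ofEmbedding ε hC hS).DeltaTheta ≃* (ThetaOrbitData.ofEmbedding ε hC hS).DeltaTheta)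
    (hind : (ThetaOrbitData.ofEmbedding ε hC hS).InducesOnTheta (ThetaOrbitData.innerAutTop x) ΓΘ)
    (hYmap : T.PiYddtp.map (ThetaOrbitData.innerAutTop x).toMulEquiv.toMonoidHom = T.PiYddtp)
    {σ₀ : D.PiTemp} (hσ₀ : σ₀ ∈ ε.dotXu)
    (hη : haveI := hC.GtpYdd_normal
      ContH1Aut.autMap D.toTheta D.DeltaTheta α.symm β.symm (symm_toTheta_eq hβ) hΔ'
          (H := D.GtpYdd) (H' := D.GtpYdd) hY E.etaDd =
        ContH1.conj D.toTheta D.DeltaTheta σ₀ E.etaDd) :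
    (ThetaOrbitData.ofEmbedding ε hC hS).transport _ (ThetaOrbitData.innerAutTop x) hYmap ΓΘ
        (ThetaOrbitData.ofEmbedding ε hC hS).etaLZ =
      (ThetaOrbitData.ofEmbedding ε hC hS).etaLZ := by
  haveI := hC.GtpYdd_normal
  haveI : ε.bot.Normal := ε.normal_bot
  have hΘ := ε.symm_coeffOf_of_induces_outer hC hS hα hβ hΔ' ΓΘ hind
  obtain ⟨h₁, h₂⟩ := ε.dotXu_stable_outer hx hα hXu hXu' hσ₀
  exact ε.outer_image_orbitColl_eq hC hα hβ hΔ hΔ' hY hY' ΓΘ hΘ (ε.outer_conj_mem_PiYddtp hα hY) hη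
    (S := ε.dotXu) h₁ h₂

/-- **Cor 2.8 (iii), clause 3 — OUTER case, modulo P-C5 only**: the same for the root collection `η̲̈^{Θ,l·ℤ}`
on `Π^tp_{Ÿ̲̲}` (`σ₀ ∈ Π^tp_{Ẋ̲̲} ∩ Π^tp_X`, `α^{±1}` stabilising `Π^tp_{X̲̲}`). [cite: MochizukiEtTh2009, Cor 2.8(iii) p.42] -/
theorem ofEmbedding_transport_outer_rootLZ (hC : D.Compat) (hS : D.Sec2Hyps) (hx : x ∈ T.PiCdot)
    (hα : ∀ g, ε.ι (α g) = x * ε.ι g * x⁻¹) (hβ : ∀ g, β (D.toTheta g) = D.toTheta (α g))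
    (hΔ : ∀ a, a ∈ D.DeltaTheta → β a ∈ D.DeltaTheta) (hΔ' : ∀ a, a ∈ D.DeltaTheta → β.symm a ∈ D.DeltaTheta)
    (hY : ∀ g, g ∈ D.GtpYdd → α g ∈ D.GtpYdd) (hY' : ∀ g, g ∈ D.GtpYdd → α.symm g ∈ D.GtpYdd)
    (hU : ∀ g, g ∈ C.Huu → α g ∈ C.Huu) (hU' : ∀ g, g ∈ C.Huu → α.symm g ∈ C.Huu)
    (ΓΘ : (ThetaOrbitData.ofEmbedding ε hC hS).DeltaTheta ≃* (ThetaOrbitData.ofEmbedding ε hC hS).DeltaTheta)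
    (hind : (ThetaOrbitData.ofEmbedding ε hC hS).InducesOnTheta (ThetaOrbitData.innerAutTop x) ΓΘ)
    (hYuu : (T.PiYddtp ⊓ T.tp T.PiXuu).map (ThetaOrbitData.innerAutTop x).toMulEquiv.toMonoidHom =
      T.PiYddtp ⊓ T.tp T.PiXuu)
    {σ₀ : D.PiTemp} (hσ₀ : σ₀ ∈ ε.dotXuu)
    (hη : haveI := hC.GtpYdd_normal
      ContH1Aut.autMap D.toTheta D.DeltaTheta α.symm β.symm (symm_toTheta_eq hβ) hΔ'
          (H := D.GtpYdd) (H' := D.GtpYdd) hY E.etaDd =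
        ContH1.conj D.toTheta D.DeltaTheta σ₀ E.etaDd) :
    (ThetaOrbitData.ofEmbedding ε hC hS).transport _ (ThetaOrbitData.innerAutTop x) hYuu ΓΘ
        (ThetaOrbitData.ofEmbedding ε hC hS).rootLZ =
      (ThetaOrbitData.ofEmbedding ε hC hS).rootLZ := by
  haveI := hC.GtpYdd_normal
  haveI : ε.bot.Normal := ε.normal_bot
  have hΘ := ε.symm_coeffOf_of_induces_outer hC hS hα hβ hΔ' ΓΘ hind
  obtain ⟨h₁, h₂⟩ := ε.dotXuu_stable_outer hx hα hU hU' hσ₀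
  exact ε.outer_image_rootColl_eq hC hα hβ hΔ hΔ' hY hY' ΓΘ hΘ (ε.outer_conj_mem_PiYddtp hα hY)
    (ε.outer_conj_mem_PiYdduu hα hY hU) (ε.outer_inv_conj_mem_PiYdduu hα hY' hU') hη (S := ε.dotXuu) h₁ h₂

/-- **Cor 2.8 (iii), clauses 3 ∧ 4 in the shape of the last two conjuncts of `ThetaOrbitData.Cor28_iii`** for
`O = ofEmbedding ε hC hS`, for EVERY `x ∈ Π^tp_Ċ` carrying an automorphism pair `(α, β)` through `ι` that
stabilises `Π^tp_Ÿ`, `Π^tp_{X̲}`, `Π^tp_{X̲̲}` and `Δ_Θ` — MODULO P-C5 with `σ₀ ∈ Π^tp_{Ẋ̲̲} ∩ Π^tp_X`.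
[cite: MochizukiEtTh2009, Cor 2.8(iii) p.42] -/
theorem ofEmbedding_cor28_iii_outer (hC : D.Compat) (hS : D.Sec2Hyps) (hx : x ∈ T.PiCdot)
    (hα : ∀ g, ε.ι (α g) = x * ε.ι g * x⁻¹) (hβ : ∀ g, β (D.toTheta g) = D.toTheta (α g))
    (hΔ : ∀ a, a ∈ D.DeltaTheta → β a ∈ D.DeltaTheta) (hΔ' : ∀ a, a ∈ D.DeltaTheta → β.symm a ∈ D.DeltaTheta)
    (hY : ∀ g, g ∈ D.GtpYdd → α g ∈ D.GtpYdd) (hY' : ∀ g, g ∈ D.GtpYdd → α.symm g ∈ D.GtpYdd)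
    (hXu : ∀ g, g ∈ D.GtpXu l → α g ∈ D.GtpXu l) (hXu' : ∀ g, g ∈ D.GtpXu l → α.symm g ∈ D.GtpXu l)
    (hU : ∀ g, g ∈ C.Huu → α g ∈ C.Huu) (hU' : ∀ g, g ∈ C.Huu → α.symm g ∈ C.Huu)
    (ΓΘ : (ThetaOrbitData.ofEmbedding ε hC hS).DeltaTheta ≃* (ThetaOrbitData.ofEmbedding ε hC hS).DeltaTheta)
    (hind : (ThetaOrbitData.ofEmbedding ε hC hS).InducesOnTheta (ThetaOrbitData.innerAutTop x) ΓΘ)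
    (hYmap : T.PiYddtp.map (ThetaOrbitData.innerAutTop x).toMulEquiv.toMonoidHom = T.PiYddtp)
    (hYuu : (T.PiYddtp ⊓ T.tp T.PiXuu).map (ThetaOrbitData.innerAutTop x).toMulEquiv.toMonoidHom =
      T.PiYddtp ⊓ T.tp T.PiXuu)
    {σ₀ : D.PiTemp} (hσ₀ : σ₀ ∈ ε.dotXuu)
    (hη : haveI := hC.GtpYdd_normal
      ContH1Aut.autMap D.toTheta D.DeltaTheta α.symm β.symm (symm_toTheta_eq hβ) hΔ'
          (H := D.GtpYdd) (H' := D.GtpYdd) hY E.etaDd =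
        ContH1.conj D.toTheta D.DeltaTheta σ₀ E.etaDd) :
    (x ∈ T.tp T.PiCuu ⊓ T.PiCdot →
      (ThetaOrbitData.ofEmbedding ε hC hS).transport _ _ hYuu ΓΘ (ThetaOrbitData.ofEmbedding ε hC hS).rootLZ =
        (ThetaOrbitData.ofEmbedding ε hC hS).rootLZ) ∧
    (x ∈ T.tp T.PiCu ⊓ T.PiCdot →
      (ThetaOrbitData.ofEmbedding ε hC hS).transport _ _ hYmap ΓΘ (ThetaOrbitData.ofEmbedding ε hC hS).etaLZ =
        (ThetaOrbitData.ofEmbedding ε hC hS).etaLZ) :=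
  ⟨fun _ => ε.ofEmbedding_transport_outer_rootLZ hC hS hx hα hβ hΔ hΔ' hY hY' hU hU' ΓΘ hind hYuu hσ₀ hη,
    fun _ => ε.ofEmbedding_transport_outer_etaLZ hC hS hx hα hβ hΔ hΔ' hY hY' hXu hXu' ΓΘ hind hYmap
      ⟨C.Huu_le_GtpXu hσ₀.1, hσ₀.2⟩ hη⟩

/-! ### The larger collections and Cor 2.8 (i) for an outer conjugator, modulo P-C5 -/

/-- `(γ_x, Γ_Θ) · η̈^{Θ,ℤ×μ₂} = η̈^{Θ,ℤ×μ₂}` for an OUTER `x ∈ Π^tp_Ċ` with its automorphism pair, modulo P-C5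
(any `σ₀ ∈ Π^tp_X`: the full `Π^tp_X`-orbit is stable). [cite: MochizukiEtTh2009, Def 2.7 p.41] -/
theorem ofEmbedding_transport_outer_etaZMu2 (hC : D.Compat) (hS : D.Sec2Hyps)
    (hα : ∀ g, ε.ι (α g) = x * ε.ι g * x⁻¹) (hβ : ∀ g, β (D.toTheta g) = D.toTheta (α g))
    (hΔ : ∀ a, a ∈ D.DeltaTheta → β a ∈ D.DeltaTheta) (hΔ' : ∀ a, a ∈ D.DeltaTheta → β.symm a ∈ D.DeltaTheta)
    (hY : ∀ g, g ∈ D.GtpYdd → α g ∈ D.GtpYdd) (hY' : ∀ g, g ∈ D.GtpYdd → α.symm g ∈ D.GtpYdd)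
    (ΓΘ : (ThetaOrbitData.ofEmbedding ε hC hS).DeltaTheta ≃* (ThetaOrbitData.ofEmbedding ε hC hS).DeltaTheta)
    (hind : (ThetaOrbitData.ofEmbedding ε hC hS).InducesOnTheta (ThetaOrbitData.innerAutTop x) ΓΘ)
    (hYmap : T.PiYddtp.map (ThetaOrbitData.innerAutTop x).toMulEquiv.toMonoidHom = T.PiYddtp)
    {σ₀ : D.PiTemp}
    (hη : haveI := hC.GtpYdd_normal
      ContH1Aut.autMap D.toTheta D.DeltaTheta α.symm β.symm (symm_toTheta_eq hβ) hΔ'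
          (H := D.GtpYdd) (H' := D.GtpYdd) hY E.etaDd =
        ContH1.conj D.toTheta D.DeltaTheta σ₀ E.etaDd) :
    (ThetaOrbitData.ofEmbedding ε hC hS).transport _ (ThetaOrbitData.innerAutTop x) hYmap ΓΘ
        (ThetaOrbitData.ofEmbedding ε hC hS).etaZMu2 =
      (ThetaOrbitData.ofEmbedding ε hC hS).etaZMu2 := by
  haveI := hC.GtpYdd_normal
  haveI : ε.bot.Normal := ε.normal_bot
  have hΘ := ε.symm_coeffOf_of_induces_outer hC hS hα hβ hΔ' ΓΘ hind
  exact ε.outer_image_orbitColl_eq hC hα hβ hΔ hΔ' hY hY' ΓΘ hΘ (ε.outer_conj_mem_PiYddtp hα hY) hη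
    (S := Set.univ) (fun _ _ => Set.mem_univ _) (fun _ _ => Set.mem_univ _)

/-- `(γ_x, Γ_Θ) · η̈^{Θ,l·ℤ×μ₂} = η̈^{Θ,l·ℤ×μ₂}` for an outer `x` (`α^{±1}` stabilising `Π^tp_{X̲}`, `σ₀ ∈ Π^tp_{X̲}`),
modulo P-C5. [cite: MochizukiEtTh2009, Def 2.7 p.41] -/
theorem ofEmbedding_transport_outer_etaLZMu2 (hC : D.Compat) (hS : D.Sec2Hyps)
    (hα : ∀ g, ε.ι (α g) = x * ε.ι g * x⁻¹) (hβ : ∀ g, β (D.toTheta g) = D.toTheta (α g))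
    (hΔ : ∀ a, a ∈ D.DeltaTheta → β a ∈ D.DeltaTheta) (hΔ' : ∀ a, a ∈ D.DeltaTheta → β.symm a ∈ D.DeltaTheta)
    (hY : ∀ g, g ∈ D.GtpYdd → α g ∈ D.GtpYdd) (hY' : ∀ g, g ∈ D.GtpYdd → α.symm g ∈ D.GtpYdd)
    (hXu : ∀ g, g ∈ D.GtpXu l → α g ∈ D.GtpXu l) (hXu' : ∀ g, g ∈ D.GtpXu l → α.symm g ∈ D.GtpXu l)
    (ΓΘ : (ThetaOrbitData.ofEmbedding ε hC hS).DeltaTheta ≃* (ThetaOrbitData.ofEmbedding ε hC hS).DeltaTheta)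
    (hind : (ThetaOrbitData.ofEmbedding ε hC hS).InducesOnTheta (ThetaOrbitData.innerAutTop x) ΓΘ)
    (hYmap : T.PiYddtp.map (ThetaOrbitData.innerAutTop x).toMulEquiv.toMonoidHom = T.PiYddtp)
    {σ₀ : D.PiTemp} (hσ₀ : σ₀ ∈ D.GtpXu l)
    (hη : haveI := hC.GtpYdd_normal
      ContH1Aut.autMap D.toTheta D.DeltaTheta α.symm β.symm (symm_toTheta_eq hβ) hΔ'
          (H := D.GtpYdd) (H' := D.GtpYdd) hY E.etaDd =
        ContH1.conj D.toTheta D.DeltaTheta σ₀ E.etaDd) :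
    (ThetaOrbitData.ofEmbedding ε hC hS).transport _ (ThetaOrbitData.innerAutTop x) hYmap ΓΘ
        (ThetaOrbitData.ofEmbedding ε hC hS).etaLZMu2 =
      (ThetaOrbitData.ofEmbedding ε hC hS).etaLZMu2 := by
  haveI := hC.GtpYdd_normal
  haveI : ε.bot.Normal := ε.normal_bot
  have hΘ := ε.symm_coeffOf_of_induces_outer hC hS hα hβ hΔ' ΓΘ hind
  exact ε.outer_image_orbitColl_eq hC hα hβ hΔ hΔ' hY hY' ΓΘ hΘ (ε.outer_conj_mem_PiYddtp hα hY) hη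
    (S := (D.GtpXu l : Set D.PiTemp))
    (fun s hs => (D.GtpXu l).mul_mem (hXu' s hs) hσ₀)
    (fun s hs => hXu _ ((D.GtpXu l).mul_mem hs ((D.GtpXu l).inv_mem hσ₀)))

/-- `(γ_x, Γ_Θ) · η̲̈^{Θ,l·ℤ×μ₂} = η̲̈^{Θ,l·ℤ×μ₂}` for an outer `x` (`α^{±1}` stabilising `Π^tp_{X̲̲}`,
`σ₀ ∈ Π^tp_{X̲̲}`), modulo P-C5. [cite: MochizukiEtTh2009, Def 2.7 p.41] -/
theorem ofEmbedding_transport_outer_rootLZMu2 (hC : D.Compat) (hS : D.Sec2Hyps)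
    (hα : ∀ g, ε.ι (α g) = x * ε.ι g * x⁻¹) (hβ : ∀ g, β (D.toTheta g) = D.toTheta (α g))
    (hΔ : ∀ a, a ∈ D.DeltaTheta → β a ∈ D.DeltaTheta) (hΔ' : ∀ a, a ∈ D.DeltaTheta → β.symm a ∈ D.DeltaTheta)
    (hY : ∀ g, g ∈ D.GtpYdd → α g ∈ D.GtpYdd) (hY' : ∀ g, g ∈ D.GtpYdd → α.symm g ∈ D.GtpYdd)
    (hU : ∀ g, g ∈ C.Huu → α g ∈ C.Huu) (hU' : ∀ g, g ∈ C.Huu → α.symm g ∈ C.Huu)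
    (ΓΘ : (ThetaOrbitData.ofEmbedding ε hC hS).DeltaTheta ≃* (ThetaOrbitData.ofEmbedding ε hC hS).DeltaTheta)
    (hind : (ThetaOrbitData.ofEmbedding ε hC hS).InducesOnTheta (ThetaOrbitData.innerAutTop x) ΓΘ)
    (hYuu : (T.PiYddtp ⊓ T.tp T.PiXuu).map (ThetaOrbitData.innerAutTop x).toMulEquiv.toMonoidHom =
      T.PiYddtp ⊓ T.tp T.PiXuu)
    {σ₀ : D.PiTemp} (hσ₀ : σ₀ ∈ C.Huu)
    (hη : haveI := hC.GtpYdd_normal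
      ContH1Aut.autMap D.toTheta D.DeltaTheta α.symm β.symm (symm_toTheta_eq hβ) hΔ'
          (H := D.GtpYdd) (H' := D.GtpYdd) hY E.etaDd =
        ContH1.conj D.toTheta D.DeltaTheta σ₀ E.etaDd) :
    (ThetaOrbitData.ofEmbedding ε hC hS).transport _ (ThetaOrbitData.innerAutTop x) hYuu ΓΘ
        (ThetaOrbitData.ofEmbedding ε hC hS).rootLZMu2 =
      (ThetaOrbitData.ofEmbedding ε hC hS).rootLZMu2 := by
  haveI := hC.GtpYdd_normal
  haveI : ε.bot.Normal := ε.normal_bot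
  have hΘ := ε.symm_coeffOf_of_induces_outer hC hS hα hβ hΔ' ΓΘ hind
  exact ε.outer_image_rootColl_eq hC hα hβ hΔ hΔ' hY hY' ΓΘ hΘ (ε.outer_conj_mem_PiYddtp hα hY)
    (ε.outer_conj_mem_PiYdduu hα hY hU) (ε.outer_inv_conj_mem_PiYdduu hα hY' hU') hη
    (S := (C.Huu : Set D.PiTemp))
    (fun s hs => C.Huu.mul_mem (hU' s hs) hσ₀)
    (fun s hs => hU _ (C.Huu.mul_mem hs (C.Huu.inv_mem hσ₀)))

/-- **Cor 2.8 (i) for an OUTER conjugator, modulo P-C5** (outer twin of abc-iut-L2-t2's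
`ofEmbedding_cor28_i_inner`, p431748): for `x ∈ Π^tp_Ċ` with its automorphism pair and `Γ_Θ` induced by `γ_x`,
ALL FOUR conclusions of `ThetaOrbitData.Cor28_i` hold at `ofEmbedding ε hC hS` — of standard type is preserved and
the three collections agree with their transports up to a root of unity of order `l`, `1`, `1` (indeed EXACTLY,
`κ = 1`) — PROVIDED P-C5 with `σ₀ ∈ Π^tp_{X̲̲}`. [cite: MochizukiEtTh2009, Cor 2.8(i) p.42] -/
theorem ofEmbedding_cor28_i_outer (hC : D.Compat) (hS : D.Sec2Hyps)
    (hstd : (ThetaOrbitData.ofEmbedding ε hC hS).IsStandard)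
    (hα : ∀ g, ε.ι (α g) = x * ε.ι g * x⁻¹) (hβ : ∀ g, β (D.toTheta g) = D.toTheta (α g))
    (hΔ : ∀ a, a ∈ D.DeltaTheta → β a ∈ D.DeltaTheta) (hΔ' : ∀ a, a ∈ D.DeltaTheta → β.symm a ∈ D.DeltaTheta)
    (hY : ∀ g, g ∈ D.GtpYdd → α g ∈ D.GtpYdd) (hY' : ∀ g, g ∈ D.GtpYdd → α.symm g ∈ D.GtpYdd)
    (hXu : ∀ g, g ∈ D.GtpXu l → α g ∈ D.GtpXu l) (hXu' : ∀ g, g ∈ D.GtpXu l → α.symm g ∈ D.GtpXu l)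
    (hU : ∀ g, g ∈ C.Huu → α g ∈ C.Huu) (hU' : ∀ g, g ∈ C.Huu → α.symm g ∈ C.Huu)
    (ΓΘ : (ThetaOrbitData.ofEmbedding ε hC hS).DeltaTheta ≃* (ThetaOrbitData.ofEmbedding ε hC hS).DeltaTheta)
    (hind : (ThetaOrbitData.ofEmbedding ε hC hS).InducesOnTheta (ThetaOrbitData.innerAutTop x) ΓΘ)
    (hYmap : T.PiYddtp.map (ThetaOrbitData.innerAutTop x).toMulEquiv.toMonoidHom = T.PiYddtp)
    (hYuu : (T.PiYddtp ⊓ T.tp T.PiXuu).map (ThetaOrbitData.innerAutTop x).toMulEquiv.toMonoidHom =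
      T.PiYddtp ⊓ T.tp T.PiXuu)
    {σ₀ : D.PiTemp} (hσ₀ : σ₀ ∈ C.Huu)
    (hη : haveI := hC.GtpYdd_normal
      ContH1Aut.autMap D.toTheta D.DeltaTheta α.symm β.symm (symm_toTheta_eq hβ) hΔ'
          (H := D.GtpYdd) (H' := D.GtpYdd) hY E.etaDd =
        ContH1.conj D.toTheta D.DeltaTheta σ₀ E.etaDd) :
    (ThetaOrbitData.ofEmbedding ε hC hS).IsStandardColl
        ((ThetaOrbitData.ofEmbedding ε hC hS).transport _ (ThetaOrbitData.innerAutTop x) hYmap ΓΘ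
          (ThetaOrbitData.ofEmbedding ε hC hS).etaZMu2) ∧
      (ThetaOrbitData.ofEmbedding ε hC hS).EqUpToRootOfUnity l _ (ThetaOrbitData.ofEmbedding ε hC hS).rootLZMu2
        ((ThetaOrbitData.ofEmbedding ε hC hS).transport _ (ThetaOrbitData.innerAutTop x) hYuu ΓΘ
          (ThetaOrbitData.ofEmbedding ε hC hS).rootLZMu2) ∧
      (ThetaOrbitData.ofEmbedding ε hC hS).EqUpToRootOfUnity 1 _ (ThetaOrbitData.ofEmbedding ε hC hS).etaZMu2
        ((ThetaOrbitData.ofEmbedding ε hC hS).transport _ (ThetaOrbitData.innerAutTop x) hYmap ΓΘ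
          (ThetaOrbitData.ofEmbedding ε hC hS).etaZMu2) ∧
      (ThetaOrbitData.ofEmbedding ε hC hS).EqUpToRootOfUnity 1 _ (ThetaOrbitData.ofEmbedding ε hC hS).etaLZMu2
        ((ThetaOrbitData.ofEmbedding ε hC hS).transport _ (ThetaOrbitData.innerAutTop x) hYmap ΓΘ
          (ThetaOrbitData.ofEmbedding ε hC hS).etaLZMu2) := by
  rw [ε.ofEmbedding_transport_outer_etaZMu2 hC hS hα hβ hΔ hΔ' hY hY' ΓΘ hind hYmap hη,
    ε.ofEmbedding_transport_outer_rootLZMu2 hC hS hα hβ hΔ hΔ' hY hY' hU hU' ΓΘ hind hYuu hσ₀ hη,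
    ε.ofEmbedding_transport_outer_etaLZMu2 hC hS hα hβ hΔ hΔ' hY hY' hXu hXu' ΓΘ hind hYmap
      (C.Huu_le_GtpXu hσ₀) hη]
  exact ⟨hstd, ThetaOrbitData.eqUpToRootOfUnity_refl _ _ _ _, ThetaOrbitData.eqUpToRootOfUnity_refl _ _ _ _,
    ThetaOrbitData.eqUpToRootOfUnity_refl _ _ _ _⟩

end ThetaSetting.EtaleThetaData.DoubleUnderline.OrbitEmbedding

end Literature.AnabelianGeometry.EtaleTheta

end
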